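import Summits.QuantumFields.YangMills.Theorems.BalabanUVNodesN15BackgroundV1TwoSidedLetters
import Summits.QuantumFields.YangMills.Theorems.BalabanUVNodesN15CovariantDerivativeSpecies
import HarnessLib

/-!
# BAŁABAN's COVARIANT LAPLACIAN (3.50) ON THE LINEAGE's PRODUCT CARRIER AND THE EXACT IDENTITY (3.53) `Δ_{U′} = Δ − V′₁(A)` IN THE KERNEL — the EXACT first-order species of a
# live gauge field around `U ≡ 1`, for ARBITRARY bond transports and for the gauge transports `exp(±η ad A)` in coordinates; the located sign on backward bonds
# (dag-n15-c g10, FILE 28; Track-A node N15 = NE2, s1 «background-layer OPERATOR ingredient»)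

`--kind definition --supports stmt-QuantumFields-20544 --as helper` (K3⁷; count-neutral).  Imports BY NAME this seat's FILE 25 `…BackgroundV1TwoSidedLetters` (through it FILE 18
`…BackgroundMatrixByPartsTwoSided`: `unstackM₂_comp_stack_eq_rightPert`, `mmulOp_add`; FILE 12: `mmulOp_sub`, `mmulOp_sum`; FILE 1 `…BackgroundTupleCalculus`: `fgrad`, `bgrad`,
`rightPert`, `linearMap_sum_comp`; M1 `unstackM`, n15-b B1b `stack`; g2 V1a∕V1b `v1coefC`, `v1coefA`, `v1fieldsOfGauge`; `coordMat_smul`, `v1coefA_inl`, `v1coefA_inr`) and n15-b part 18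
`…CovariantDerivativeSpecies` (`covD`, `covD_apply`, `Phi0`; through it parts 13a∕14∕16: `Phi1`, `Phi2`, `mmulOp`, `liftEquiv`, `liftMap`, `coordMat`, `coordMat_sub`, [Lit] `adCLM`,
`adCLM_add`, `adCLM_smul`); nothing in the tree is modified.

THE PRINT (first-hand, [Balaban1985BackgroundPropagators] p. 400).  (3.50): «(Δ_{U′U}λ)(x) = η^{−2}(2dλ(x) − Σ_{b∈st(x)} exp(iη ad_{A′(b)}) R(U_b)λ(b₊))», `A′(b) = A(b)` on positively oriented
bonds and `A′(b) = R(U_b)A(b)` on negatively oriented ones, where a lattice gauge field has `U(b̄) = U(b)⁻¹`, i.e. `A(b̄) = −A(b)`; (3.51)–(3.52): expanding `exp(iη ad) = 1 + iη ad +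
η²F′_{1,k}(i ad)`, `F′_{1,k}(z) = η^{−2}(e^{ηz} − 1 − ηz)`, gives the FIRST-ORDER DIFFERENCE OPERATOR `V′₁(A)`; (3.53): «Δ_{U′U} = Δ_U − V′₁(A)» — an EXACT identity (no truncation:
`F′_{1,k}` carries every order in `A`).  AT `U ≡ 1` (`R(U_b) = 1`) the transports are `exp(η ad A_μ(x))` on the forward bond `(x, x + e_μ)` and `exp(−η ad A_μ(x − e_μ))` on the backward
bond `(x, x − e_μ)`.

WHAT.  §1 (arbitrary transports `R : J ⊕ J → X → Matrix ι ι ℝ`, forward on `inl`, backward on `inr`; shifts `τ_μ`; spacing `η`): `covLapM` (def) — Bałaban's (3.50)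
`−η⁻¹Σ_μ[D^η_{R⁺_μ, τ_μ} + D^η_{R⁻_μ, τ_μ⁻¹}]` built from n15-b's covariant derivative `covD` BY NAME (`covLapM_apply`: the printed pointwise form); `speciesOpM` (def) — the lineage's
two-sided species operator `M_C + Σ_μ[M_{A⁺_μ}∇⁺_μ + M_{A⁻_μ}∇⁻_μ]` on `X × ι` (FILE 1 `fgrad` ∕ `bgrad`), with `rightPert_eq_speciesOpM_comp` and ★ `unstackM_comp_stack_eq_speciesOpM_comp`
(M1's unstacked perturbation after the stack IS `V∘G` — the bridge to `bgPairM`); `tCoefA` ∕ `tCoefC` (defs) — the EXACT coefficients `a⁺ = η⁻¹(R⁺ − 1)`, `a⁻ = η⁻¹(1 − R⁻)`,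
`c = η⁻¹Σ_μ(a⁺_μ − a⁻_μ)`; `covLapM_one_eq` (`Δ_1 = η⁻¹Σ_μ(∇⁻_μ − ∇⁺_μ)`); ★★ **`covLapM_eq_one_sub_speciesOpM`**: `Δ_R = Δ_1 − V(tCoefC, tCoefA)` — (3.53) FOR ARBITRARY TRANSPORTS, kernel-checked operator identity.
§2 (a gauge field `A : J → X → 𝔄` in coordinates `e : 𝔄 ≃L ℝ^ι`): `gaugeTransport` (def: `R⁺_μ = coordMat e (exp(η ad A_μ))`, `R⁻_μ = coordMat e (exp(−η ad A_μ(· − e_μ)))` via n15-b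
`Phi0`), `v1coefAX` ∕ `v1coefCX` (defs) — THE EXACT (3.52) COEFFICIENTS in g2's format: `a⁺_μ = coordMat(ad A⁺_μ) + η·coordMat(F′_η(ad A⁺_μ))`, `a⁻_μ = coordMat(ad A⁻_μ) −
η·coordMat(F′_{−η}(ad A⁻_μ))`, `c = coordMat(ad W) + Σ_μ[coordMat(F′_η(ad A⁺_μ)) + coordMat(F′_{−η}(ad A⁻_μ))]` with `F′_{−η}(Z) = Phi2 (−η) Z = F′_η(−Z)` (`Phi2_neg`); `Phi1_eq_add_smul_Phi2`
(`Φ₁ = id + ηΦ₂`, all `η`), `Phi1_eq_smul` ∕ `Phi1_neg_eq_smul`; `tCoefA_gaugeTransport` ∕ `tCoefC_gaugeTransport` (the transport coefficients ARE these); ★★ **`covLapM_gaugeTransport_eq`**: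
(3.53) at `U ≡ 1` for a live gauge field, EXACT.  §3 THE LOCATED SIGN: `v1coefAX_inl_eq_v1coefA` (forward components = g2's `v1coefA`), `v1coefA_inr_sub_v1coefAX_inr` ∕ `v1coefC_sub_v1coefCX` (the
backward `F′`-terms of g2's `v1coefA` ∕ `v1coefC`
(p468147) carry `F′_η(ad A⁻)` where (3.50) gives `F′_η(−ad A⁻)`: the difference is `η·coordMat(F′_η(Z) − F′_η(−Z))` ∕ `coordMat(F′_η(Z) − F′_η(−Z))` per backward bond — zero through
SECOND order in `A`, `O(η(ad A)³)` beyond; every theorem of the lineage about `v1coefA`∕`v1coefC` stands as a theorem about a (3.52)-SHAPED species, as its docstrings say).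

HONEST FRAMING.  Kernel-checked ALGEBRA (operator identities on a finite product carrier) + plumbing defs; NO estimate; `U ≡ 1` background (the global small-field chart
`U′ = e^{iηA}`), `𝔤 ↦ 𝔄` with coordinates `e`; the gauge-fixing term `DRD*` and the averaging term `Q*aQ` of `Δ_a` (3.26) are NOT touched here (their `U′`-dependence — (3.55)–(3.68) —
is not part of `V′₁`); NE2⁺ NOT PRINTED, not claimed; count-neutral; N15 NOT discharged; one finite torus at fixed ε — NOT ℝ⁴, NOT infinite volume, NOT OS, NOT a mass gap, NOT Clay.
-/

noncomputable section

open scoped BigOperators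
open Finset
namespace Summit.QuantumFields.YangMills.BalabanUVNodes.N15.BackgroundLayer

open NormedSpace
open Literature.MathematicalPhysics.QuantumFieldTheory.Balaban1983to89
open Literature.MathematicalPhysics.QuantumFieldTheory.Balaban1983to89.T4EtaRateCoeffDefect (pull pull_apply)
open Literature.MathematicalPhysics.QuantumFieldTheory.Balaban1983to89.Beta.AveragingCorrectionJets (adCLM adL adCLM_add adCLM_smul adCLM_zero adCLM_eq_adL)
open Summit.QuantumFields.YangMills.BalabanUVNodes.N15.DerivDefect (fdiffN fdiffN_apply)
open Summit.QuantumFields.YangMills.BalabanUVNodes.N15.MatrixSpecies (mmulOp mmulOp_apply liftMap liftEquiv liftEquiv_apply liftEquiv_symm_apply coordMat coordMat_sub Phi0 Phi1 Phi2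
  covD covD_apply mmulOp_comp_mmulOp adCLM_sub)

/-! ## §1 The covariant Laplacian for arbitrary bond transports and the exact identity (3.53) -/

section Transports

variable {X J ι : Type} [Fintype J] [Fintype ι] [DecidableEq ι] (τ : J → X ≃ X)

/-- THE TWO-SIDED SPECIES OPERATOR `V = M_C + Σ_μ [M_{A⁺_μ}∇⁺_μ + M_{A⁻_μ}∇⁻_μ]` on the product carrier `X × ι` (zeroth-order matrix field `C`, forward coefficients `A (inl μ)` on
`∇⁺_μ = fgrad n τ_μ`, backward coefficients `A (inr μ)` on `∇⁻_μ = bgrad n τ_μ`) — the first-order difference operator of (3.52). [cite: Balaban1985BackgroundPropagators, (3.52) p.400 (shape)] -/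
def speciesOpM (n : ℝ) (C : X → Matrix ι ι ℝ) (A : J ⊕ J → X → Matrix ι ι ℝ) : (X × ι → ℝ) →ₗ[ℝ] (X × ι → ℝ) :=
  mmulOp C + ∑ μ, (mmulOp (A (Sum.inl μ)) ∘ₗ fgrad n (liftEquiv (τ μ) ι) + mmulOp (A (Sum.inr μ)) ∘ₗ bgrad n (liftEquiv (τ μ) ι))

omit [DecidableEq ι] in
/-- FILE 1's right perturbation with matrix coefficient operators IS the species operator after the propagator: `W = V∘G`. [cite: Balaban1985BackgroundPropagators, (3.63)–(3.64) p.402 (V′(A)G′(U): shape)] -/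
theorem rightPert_eq_speciesOpM_comp (n : ℝ) (G : (X × ι → ℝ) →ₗ[ℝ] (X × ι → ℝ)) (C : X → Matrix ι ι ℝ) (A : J ⊕ J → X → Matrix ι ι ℝ) :
    rightPert (fun μ => liftEquiv (τ μ) ι) n G (mmulOp C) (fun μ => mmulOp (A (Sum.inl μ))) (fun μ => mmulOp (A (Sum.inr μ))) = speciesOpM τ n C A ∘ₗ G := by
  simp only [rightPert, speciesOpM, LinearMap.add_comp, linearMap_sum_comp, LinearMap.comp_assoc]

omit [DecidableEq ι] in
/-- ★ THE BRIDGE TO M1's DRESSED PAIR: when the derived pieces are the forward ∕ backward quotients of `G`, the unstacked perturbation after the stack IS `V∘G` (FILE 18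
`unstackM₂_comp_stack_eq_rightPert`). [cite: Balaban1985BackgroundPropagators, (3.63)–(3.64) p.402 (shape)] -/
theorem unstackM_comp_stack_eq_speciesOpM_comp (n : ℝ) (G : (X × ι → ℝ) →ₗ[ℝ] (X × ι → ℝ)) (C : X → Matrix ι ι ℝ) (A : J ⊕ J → X → Matrix ι ι ℝ)
    {D : J ⊕ J → (X × ι → ℝ) →ₗ[ℝ] (X × ι → ℝ)} (hDf : ∀ μ, D (Sum.inl μ) = fgrad n (liftEquiv (τ μ) ι) ∘ₗ G) (hDb : ∀ μ, D (Sum.inr μ) = bgrad n (liftEquiv (τ μ) ι) ∘ₗ G) :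
    unstackM C A ∘ₗ stack G D = speciesOpM τ n C A ∘ₗ G := by
  rw [unstackM₂_comp_stack_eq_rightPert τ n G C A hDf hDb, rightPert_eq_speciesOpM_comp]

/-- **BAŁABAN's COVARIANT LAPLACIAN (3.50)** on the product carrier for bond transports `R` (forward `R (inl μ)` on `(x, τ_μ x)`, backward `R (inr μ)` on `(x, τ_μ⁻¹ x)`):
`Δ_R = −η⁻¹ Σ_μ [D^η_{R⁺_μ, τ_μ} + D^η_{R⁻_μ, τ_μ⁻¹}]`, `D^η_{R,s}f(x) = η⁻¹(R(x)f(sx) − f(x))` (n15-b `covD`). [cite: Balaban1985BackgroundPropagators, (3.50) p.400 + (3.23) p.394] -/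
def covLapM (η : ℝ) (R : J ⊕ J → X → Matrix ι ι ℝ) : (X × ι → ℝ) →ₗ[ℝ] (X × ι → ℝ) :=
  -(η⁻¹ • ∑ μ, (covD η (R (Sum.inl μ)) (τ μ) + covD η (R (Sum.inr μ)) (τ μ).symm))

/-- THE PRINTED POINTWISE FORM of (3.50): `(Δ_R f)(x, i) = η⁻²Σ_μ[(f(x,i) − Σ_j R⁺_μ(x)_{ij}f(τ_μx, j)) + (f(x,i) − Σ_j R⁻_μ(x)_{ij}f(τ_μ⁻¹x, j))]` («η^{−2}(2dλ(x) − Σ_{b∈st(x)} R_b λ(b₊))»).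
[cite: Balaban1985BackgroundPropagators, (3.50) p.400] -/
theorem covLapM_apply (η : ℝ) (R : J ⊕ J → X → Matrix ι ι ℝ) (f : X × ι → ℝ) (p : X × ι) :
    covLapM τ η R f p = η⁻¹ * η⁻¹ * ∑ μ, ((f p - ∑ j, R (Sum.inl μ) p.1 p.2 j * f (τ μ p.1, j)) + (f p - ∑ j, R (Sum.inr μ) p.1 p.2 j * f ((τ μ).symm p.1, j))) := by
  simp only [covLapM, LinearMap.neg_apply, LinearMap.smul_apply, LinearMap.coe_sum, Finset.sum_apply, LinearMap.add_apply, Pi.neg_apply, Pi.smul_apply, Pi.add_apply,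
    covD_apply, smul_eq_mul, Finset.mul_sum, ← Finset.sum_neg_distrib]
  exact Finset.sum_congr rfl fun μ _ => by ring

/-- THE EXACT FIRST-ORDER COEFFICIENTS OF THE TRANSPORTS: `a⁺_μ = η⁻¹(R⁺_μ − 1)` (forward, `inl`), `a⁻_μ = η⁻¹(1 − R⁻_μ)` (backward, `inr`). [cite: Balaban1985BackgroundPropagators, (3.51)–(3.52) p.400] -/
def tCoefA (η : ℝ) (R : J ⊕ J → X → Matrix ι ι ℝ) : J ⊕ J → X → Matrix ι ι ℝ :=
  Sum.elim (fun μ x => η⁻¹ • (R (Sum.inl μ) x - 1)) (fun μ x => η⁻¹ • (1 - R (Sum.inr μ) x))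

/-- THE EXACT ZEROTH-ORDER COEFFICIENT: `c = η⁻¹Σ_μ(a⁺_μ − a⁻_μ) = η⁻²Σ_μ(R⁺_μ + R⁻_μ − 2)`. [cite: Balaban1985BackgroundPropagators, (3.51)–(3.52) p.400] -/
def tCoefC (η : ℝ) (R : J ⊕ J → X → Matrix ι ι ℝ) : X → Matrix ι ι ℝ :=
  fun x => η⁻¹ • ∑ μ, (tCoefA η R (Sum.inl μ) x - tCoefA η R (Sum.inr μ) x)

omit [Fintype J] [Fintype ι] in
/-- Unfolding. [folklore] -/
@[simp] theorem tCoefA_inl (η : ℝ) (R : J ⊕ J → X → Matrix ι ι ℝ) (μ : J) (x : X) : tCoefA η R (Sum.inl μ) x = η⁻¹ • (R (Sum.inl μ) x - 1) := rfl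

omit [Fintype J] [Fintype ι] in
/-- Unfolding (backward). [folklore] -/
@[simp] theorem tCoefA_inr (η : ℝ) (R : J ⊕ J → X → Matrix ι ι ℝ) (μ : J) (x : X) : tCoefA η R (Sum.inr μ) x = η⁻¹ • (1 - R (Sum.inr μ) x) := rfl

omit [Fintype J] [DecidableEq ι] in
/-- `mmulOp` is homogeneous: `M_{c•C} = c•M_C`. [folklore] -/
theorem mmulOp_smul (c : ℝ) (C : X → Matrix ι ι ℝ) : mmulOp (c • C) = c • mmulOp C := by
  refine LinearMap.ext fun f => funext fun p => ?_
  simp only [mmulOp_apply, LinearMap.smul_apply, Pi.smul_apply, Matrix.smul_apply, smul_eq_mul, Finset.mul_sum, mul_assoc]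

omit [Fintype J] [Fintype ι] [DecidableEq ι] in
/-- n15-b's normalised forward difference along the lifted shift IS FILE 1's forward quotient at `n = η⁻¹`. [folklore] -/
theorem fdiffN_liftMap_eq_fgrad (η : ℝ) (s : X ≃ X) : fdiffN η (liftMap s ι) = fgrad η⁻¹ (liftEquiv s ι) := by
  refine LinearMap.ext fun f => funext fun p => ?_
  simp only [fdiffN_apply, fgrad_apply, liftEquiv_apply]

omit [Fintype J] [Fintype ι] [DecidableEq ι] in
/-- … and along the inverse shift it is MINUS FILE 1's backward quotient. [folklore] -/
theorem fdiffN_liftMap_symm_eq_neg_bgrad (η : ℝ) (s : X ≃ X) : fdiffN η (liftMap s.symm ι) = -bgrad η⁻¹ (liftEquiv s ι) := by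
  refine LinearMap.ext fun f => funext fun p => ?_
  simp only [fdiffN_apply, LinearMap.neg_apply, Pi.neg_apply, bgrad_apply, liftEquiv_symm_apply]
  ring

omit [Fintype J] in
/-- ONE FORWARD BOND, normal-ordered: `−η⁻¹D^η_{R,s} = −η⁻¹∇ − (M_a∇ + η⁻¹M_a)`, `a = η⁻¹(R − 1)`, `∇ = fgrad η⁻¹ s` (`R = 1 + ηa` inside the derivative). [cite: Balaban1985BackgroundPropagators, (3.51) p.400 (the expansion step)] -/
theorem neg_smul_covD_fwd (η : ℝ) (R : X → Matrix ι ι ℝ) (s : X ≃ X) :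
    -(η⁻¹ • covD η R s) = -(η⁻¹ • fgrad η⁻¹ (liftEquiv s ι)) -
      (mmulOp (fun x => η⁻¹ • (R x - 1)) ∘ₗ fgrad η⁻¹ (liftEquiv s ι) + η⁻¹ • mmulOp (fun x => η⁻¹ • (R x - 1))) := by
  refine LinearMap.ext fun f => funext fun p => ?_
  simp only [LinearMap.neg_apply, LinearMap.smul_apply, LinearMap.sub_apply, LinearMap.add_apply, LinearMap.comp_apply, Pi.neg_apply, Pi.smul_apply, Pi.sub_apply, Pi.add_apply,
    covD_apply, fgrad_apply, mmulOp_apply, liftEquiv_apply, Matrix.smul_apply, Matrix.sub_apply, Matrix.one_apply, smul_eq_mul]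
  have h1 : ∑ j, η⁻¹ * (R p.1 p.2 j - if p.2 = j then 1 else 0) * (η⁻¹ * (f (s p.1, j) - f (p.1, j))) =
      η⁻¹ * η⁻¹ * (∑ j, R p.1 p.2 j * f (s p.1, j) - ∑ j, R p.1 p.2 j * f (p.1, j)) - η⁻¹ * η⁻¹ * (f (s p.1, p.2) - f p) := by
    have : ∀ j, η⁻¹ * (R p.1 p.2 j - if p.2 = j then 1 else 0) * (η⁻¹ * (f (s p.1, j) - f (p.1, j))) =
        η⁻¹ * η⁻¹ * (R p.1 p.2 j * f (s p.1, j) - R p.1 p.2 j * f (p.1, j)) - (if p.2 = j then η⁻¹ * η⁻¹ * (f (s p.1, j) - f (p.1, j)) else 0) := by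
      intro j; split_ifs <;> ring
    rw [Finset.sum_congr rfl fun j _ => this j, Finset.sum_sub_distrib, Finset.sum_ite_eq, if_pos (Finset.mem_univ _), ← Finset.mul_sum, Finset.sum_sub_distrib]
  have h2 : ∑ j, η⁻¹ * (R p.1 p.2 j - if p.2 = j then 1 else 0) * f (p.1, j) = η⁻¹ * ∑ j, R p.1 p.2 j * f (p.1, j) - η⁻¹ * f p := by
    have : ∀ j, η⁻¹ * (R p.1 p.2 j - if p.2 = j then 1 else 0) * f (p.1, j) = η⁻¹ * (R p.1 p.2 j * f (p.1, j)) - (if p.2 = j then η⁻¹ * f (p.1, j) else 0) := by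
      intro j; split_ifs <;> ring
    rw [Finset.sum_congr rfl fun j _ => this j, Finset.sum_sub_distrib, Finset.sum_ite_eq, if_pos (Finset.mem_univ _), ← Finset.mul_sum]
  rw [h1, h2]
  ring

omit [Fintype J] in
/-- ONE BACKWARD BOND, normal-ordered: `−η⁻¹D^η_{R,s⁻¹} = −η⁻¹∇′ − (M_a∇⁻ − η⁻¹M_a)`, `a = η⁻¹(1 − R)`, `∇′ = fdiffN η s⁻¹ = −∇⁻`, `∇⁻ = bgrad η⁻¹ s` (`R = 1 − ηa`).
[cite: Balaban1985BackgroundPropagators, (3.51) p.400 (the expansion step, negatively oriented bonds)] -/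
theorem neg_smul_covD_bwd (η : ℝ) (R : X → Matrix ι ι ℝ) (s : X ≃ X) :
    -(η⁻¹ • covD η R s.symm) = -(η⁻¹ • fdiffN η (liftMap s.symm ι)) -
      (mmulOp (fun x => η⁻¹ • (1 - R x)) ∘ₗ bgrad η⁻¹ (liftEquiv s ι) - η⁻¹ • mmulOp (fun x => η⁻¹ • (1 - R x))) := by
  refine LinearMap.ext fun f => funext fun p => ?_
  simp only [LinearMap.neg_apply, LinearMap.smul_apply, LinearMap.sub_apply, LinearMap.comp_apply, Pi.neg_apply, Pi.smul_apply, Pi.sub_apply, covD_apply, fdiffN_apply,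
    bgrad_apply, mmulOp_apply, liftEquiv_symm_apply, Matrix.smul_apply, Matrix.sub_apply, Matrix.one_apply, smul_eq_mul]
  have h1 : ∑ j, η⁻¹ * ((if p.2 = j then 1 else 0) - R p.1 p.2 j) * (η⁻¹ * (f (p.1, j) - f (s.symm p.1, j))) =
      η⁻¹ * η⁻¹ * (f p - f (s.symm p.1, p.2)) - η⁻¹ * η⁻¹ * (∑ j, R p.1 p.2 j * f (p.1, j) - ∑ j, R p.1 p.2 j * f (s.symm p.1, j)) := by
    have : ∀ j, η⁻¹ * ((if p.2 = j then 1 else 0) - R p.1 p.2 j) * (η⁻¹ * (f (p.1, j) - f (s.symm p.1, j))) =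
        (if p.2 = j then η⁻¹ * η⁻¹ * (f (p.1, j) - f (s.symm p.1, j)) else 0) - η⁻¹ * η⁻¹ * (R p.1 p.2 j * f (p.1, j) - R p.1 p.2 j * f (s.symm p.1, j)) := by
      intro j; split_ifs <;> ring
    rw [Finset.sum_congr rfl fun j _ => this j, Finset.sum_sub_distrib, Finset.sum_ite_eq, if_pos (Finset.mem_univ _), ← Finset.mul_sum, Finset.sum_sub_distrib]
  have h2 : ∑ j, η⁻¹ * ((if p.2 = j then 1 else 0) - R p.1 p.2 j) * f (p.1, j) = η⁻¹ * f p - η⁻¹ * ∑ j, R p.1 p.2 j * f (p.1, j) := by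
    have : ∀ j, η⁻¹ * ((if p.2 = j then 1 else 0) - R p.1 p.2 j) * f (p.1, j) = (if p.2 = j then η⁻¹ * f (p.1, j) else 0) - η⁻¹ * (R p.1 p.2 j * f (p.1, j)) := by
      intro j; split_ifs <;> ring
    rw [Finset.sum_congr rfl fun j _ => this j, Finset.sum_sub_distrib, Finset.sum_ite_eq, if_pos (Finset.mem_univ _), ← Finset.mul_sum]
  rw [h1, h2]
  ring

omit [Fintype J] in
/-- The trivial transport: `D^η_{1,s} = ∇` (n15-b's normalised forward difference). [folklore] -/
theorem covD_one (η : ℝ) (s : X → X) : covD η (fun _ : X => (1 : Matrix ι ι ℝ)) s = fdiffN η (liftMap s ι) := by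
  refine LinearMap.ext fun f => funext fun p => ?_
  simp only [covD_apply, fdiffN_apply, Matrix.one_apply, ite_mul, one_mul, zero_mul, Finset.sum_ite_eq, Finset.mem_univ, if_true]

/-- THE FLAT LAPLACIAN (`R ≡ 1`) IN THE LINEAGE's QUOTIENTS: `Δ_1 = η⁻¹Σ_μ(∇⁻_μ − ∇⁺_μ)` (`= η⁻²Σ_μ(2 − S_μ − S_μ⁻¹)`, the positive nearest-neighbour Laplacian ⊗ 1_ι).
[cite: Balaban1985BackgroundPropagators, (3.50) p.400 (at U ≡ 1, A = 0)] -/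
theorem covLapM_one_eq (η : ℝ) :
    covLapM τ η (fun (_ : J ⊕ J) (_ : X) => (1 : Matrix ι ι ℝ)) = η⁻¹ • ∑ μ, (bgrad η⁻¹ (liftEquiv (τ μ) ι) - fgrad η⁻¹ (liftEquiv (τ μ) ι)) := by
  rw [covLapM, Finset.smul_sum, Finset.smul_sum, ← Finset.sum_neg_distrib]
  refine Finset.sum_congr rfl fun μ _ => ?_
  rw [show (fun _ : X => (1 : Matrix ι ι ℝ)) = fun _ => 1 from rfl, covD_one, covD_one, fdiffN_liftMap_eq_fgrad, fdiffN_liftMap_symm_eq_neg_bgrad, ← smul_neg,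
    neg_add, neg_neg, add_comm, sub_eq_add_neg]

/-- ★★ **(3.53) FOR ARBITRARY TRANSPORTS, EXACT**: `Δ_R = Δ_1 − V(c, a)` with the exact coefficients `a⁺ = η⁻¹(R⁺ − 1)`, `a⁻ = η⁻¹(1 − R⁻)`, `c = η⁻¹Σ_μ(a⁺_μ − a⁻_μ)` and
the species operator at `n = η⁻¹` — Bałaban's «Δ_{U′U} = Δ_U − V′₁(A)» as a kernel-checked operator identity on the product carrier (every `η`; at `η = 0` both sides vanish
by the `0⁻¹ = 0` convention).
[cite: Balaban1985BackgroundPropagators, (3.50)–(3.53) p.400] -/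
theorem covLapM_eq_one_sub_speciesOpM (η : ℝ) (R : J ⊕ J → X → Matrix ι ι ℝ) :
    covLapM τ η R = covLapM τ η (fun _ _ => 1) - speciesOpM τ η⁻¹ (tCoefC η R) (tCoefA η R) := by
  have hL : covLapM τ η R = ∑ μ, (-(η⁻¹ • covD η (R (Sum.inl μ)) (τ μ)) + -(η⁻¹ • covD η (R (Sum.inr μ)) (τ μ).symm)) := by
    rw [covLapM, Finset.smul_sum, ← Finset.sum_neg_distrib]
    exact Finset.sum_congr rfl fun μ _ => by rw [smul_add, neg_add]
  have h1 : covLapM τ η (fun _ _ => (1 : Matrix ι ι ℝ)) = ∑ μ, (-(η⁻¹ • fgrad η⁻¹ (liftEquiv (τ μ) ι)) + -(η⁻¹ • fdiffN η (liftMap (τ μ).symm ι))) := by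
    rw [covLapM, Finset.smul_sum, ← Finset.sum_neg_distrib]
    refine Finset.sum_congr rfl fun μ _ => ?_
    rw [show (fun _ : X => (1 : Matrix ι ι ℝ)) = fun _ => 1 from rfl, covD_one, covD_one, fdiffN_liftMap_eq_fgrad, smul_add, neg_add]
  have hC : mmulOp (tCoefC η R) = η⁻¹ • ∑ μ, (mmulOp (tCoefA η R (Sum.inl μ)) - mmulOp (tCoefA η R (Sum.inr μ))) := by
    have : tCoefC η R = η⁻¹ • ∑ μ, (tCoefA η R (Sum.inl μ) - tCoefA η R (Sum.inr μ)) := by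
      funext x
      simp only [tCoefC, Pi.smul_apply, Finset.sum_apply, Pi.sub_apply]
    rw [this, mmulOp_smul, mmulOp_sum]
    congr 1
    exact Finset.sum_congr rfl fun μ _ => mmulOp_sub _ _
  rw [hL, h1, speciesOpM, hC, Finset.smul_sum, ← Finset.sum_add_distrib, ← Finset.sum_sub_distrib]
  refine Finset.sum_congr rfl fun μ _ => ?_
  have hf := neg_smul_covD_fwd (ι := ι) η (R (Sum.inl μ)) (τ μ)
  have hb := neg_smul_covD_bwd (ι := ι) η (R (Sum.inr μ)) (τ μ)
  have ha : (fun x => η⁻¹ • (R (Sum.inl μ) x - 1)) = tCoefA η R (Sum.inl μ) := rfl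
  have hb' : (fun x => η⁻¹ • (1 - R (Sum.inr μ) x)) = tCoefA η R (Sum.inr μ) := rfl
  rw [ha] at hf
  rw [hb'] at hb
  rw [hf, hb, smul_sub]
  abel

end Transports

/-! ## §2 The gauge transports `exp(±η ad A)` in coordinates and the exact coefficients of (3.52) -/

section Species

variable {𝔸 : Type*} [NormedRing 𝔸] [NormedAlgebra ℝ 𝔸]

/-- `Φ₁ = id + η·Φ₂` at EVERY spacing (also `η = 0` and `η < 0`): `η⁻¹(e^{ηZ} − 1) = Z + η·η⁻²(e^{ηZ} − 1 − ηZ)`. [folklore] -/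
theorem Phi1_eq_add_smul_Phi2 (η : ℝ) (Z : 𝔸) : Phi1 η Z = Z + η • Phi2 η Z := by
  by_cases h : η = 0
  · subst h
    rw [zero_smul, add_zero, MatrixSpecies.Phi1_zero]
  · simp only [Phi1, Phi2, if_neg h]
    have h2 : η * (η ^ 2)⁻¹ = η⁻¹ := by field_simp
    have h3 : η⁻¹ • (exp (η • Z) - 1 - η • Z) = η⁻¹ • (exp (η • Z) - 1) - Z := by
      rw [smul_sub η⁻¹ (exp (η • Z) - 1), smul_smul, inv_mul_cancel₀ h, one_smul]
    rw [smul_smul, h2, h3]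
    abel

/-- `F′_{−η}(Z) = F′_η(−Z)`: the second-order species at negative spacing is the species of the negated letter. [folklore] -/
theorem Phi2_neg (η : ℝ) (Z : 𝔸) : Phi2 (-η) Z = Phi2 η (-Z) := by
  by_cases h : η = 0
  · subst h
    rw [neg_zero, MatrixSpecies.Phi2_zero, MatrixSpecies.Phi2_zero, neg_sq]
  · have h' : -η ≠ 0 := neg_ne_zero.mpr h
    simp only [Phi2, if_neg h, if_neg h', neg_sq, smul_neg, neg_smul, sub_neg_eq_add]

/-- `Φ₁(η, Z) = η⁻¹(Φ₀(η, Z) − 1)` for `η ≠ 0` (`Φ₀ = exp(η·)`, n15-b part 18). [folklore] -/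
theorem Phi1_eq_smul {η : ℝ} (hη : η ≠ 0) (Z : 𝔸) : Phi1 η Z = η⁻¹ • (Phi0 η Z - 1) := by
  simp only [Phi1, Phi0, if_neg hη]

/-- `Φ₁(−η, Z) = η⁻¹(1 − Φ₀(−η, Z))` for `η ≠ 0`: the backward coefficient `η⁻¹(1 − e^{−ηZ})`. [folklore] -/
theorem Phi1_neg_eq_smul {η : ℝ} (hη : η ≠ 0) (Z : 𝔸) : Phi1 (-η) Z = η⁻¹ • (1 - Phi0 (-η) Z) := by
  have hη' : -η ≠ 0 := neg_ne_zero.mpr hη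
  simp only [Phi1, Phi0, if_neg hη', inv_neg, neg_smul, ← smul_neg, neg_sub]

end Species

section Gauge

variable {X J ι : Type} [Fintype J] [Fintype ι] [DecidableEq ι] {𝔄 : Type} [NormedRing 𝔄] [NormedAlgebra ℝ 𝔄] (e : 𝔄 ≃L[ℝ] (ι → ℝ))

omit [Fintype J] in
/-- Coordinates are additive. [folklore] -/
theorem coordMat_add (T₁ T₂ : 𝔄 →L[ℝ] 𝔄) : coordMat e (T₁ + T₂) = coordMat e T₁ + coordMat e T₂ := by
  ext i j
  simp [coordMat, LinearMap.toMatrix'_apply]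

/-- Coordinates of a finite sum. [folklore] -/
theorem coordMat_sum (T : J → 𝔄 →L[ℝ] 𝔄) : coordMat e (∑ μ, T μ) = ∑ μ, coordMat e (T μ) := by
  have hz : coordMat e (0 : 𝔄 →L[ℝ] 𝔄) = 0 := by
    ext i j
    simp [coordMat, LinearMap.toMatrix'_apply]
  let φ : (𝔄 →L[ℝ] 𝔄) →+ Matrix ι ι ℝ := { toFun := coordMat e, map_zero' := hz, map_add' := coordMat_add e }
  exact map_sum φ T Finset.univ

omit [Fintype J] in
/-- The identity of `𝔄` has the identity matrix in any coordinates. [folklore] -/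
theorem coordMat_one : coordMat e (1 : 𝔄 →L[ℝ] 𝔄) = 1 := by
  ext i j
  simp [coordMat, LinearMap.toMatrix'_apply, Matrix.one_apply, Pi.single_apply]

/-- THE GAUGE TRANSPORTS AT `U ≡ 1` in coordinates: forward bond `(x, x + e_μ)` ↦ `coordMat e (exp(η ad A_μ(x)))`, backward bond `(x, x − e_μ)` ↦ `coordMat e (exp(−η ad A_μ(x − e_μ)))`
(`U′(b̄) = U′(b)⁻¹`; n15-b `Phi0 η Z = exp(ηZ)`). [cite: Balaban1985BackgroundPropagators, (3.50) p.400] -/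
def gaugeTransport (τ : J → X ≃ X) (η : ℝ) (A : J → X → 𝔄) : J ⊕ J → X → Matrix ι ι ℝ :=
  Sum.elim (fun μ x => coordMat e (Phi0 η (adCLM ℝ (A μ x)))) (fun μ x => coordMat e (Phi0 (-η) (adCLM ℝ (A μ ((τ μ).symm x)))))

/-- **THE EXACT FIRST-ORDER COEFFICIENTS OF (3.52)** on the forward∕backward stack, in coordinates: `a⁺_μ = coordMat(ad A⁺_μ) + η·coordMat(F′_η(ad A⁺_μ))` (`inl μ`),
`a⁻_μ = coordMat(ad A⁻_μ) − η·coordMat(F′_{−η}(ad A⁻_μ))` (`inr μ`), `F′_{−η}(Z) = F′_η(−Z)`; i.e. `a^±_μ = coordMat(Φ₁(±η, ad A^±_μ))`.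
[cite: Balaban1985BackgroundPropagators, (3.50)–(3.52) p.400] -/
def v1coefAX (η : ℝ) (U : (J → X → 𝔄) × (J → X → 𝔄) × (X → 𝔄)) : J ⊕ J → X → Matrix ι ι ℝ :=
  Sum.elim (fun μ x => coordMat e (adCLM ℝ (U.1 μ x)) + η • coordMat e (Phi2 η (adCLM ℝ (U.1 μ x))))
    (fun μ x => coordMat e (adCLM ℝ (U.2.1 μ x)) - η • coordMat e (Phi2 (-η) (adCLM ℝ (U.2.1 μ x))))

/-- **THE EXACT ZEROTH-ORDER COEFFICIENT OF (3.52)**: `c = coordMat(ad W) + Σ_μ [coordMat(F′_η(ad A⁺_μ)) + coordMat(F′_{−η}(ad A⁻_μ))]`.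
[cite: Balaban1985BackgroundPropagators, (3.50)–(3.52) p.400] -/
def v1coefCX (η : ℝ) (U : (J → X → 𝔄) × (J → X → 𝔄) × (X → 𝔄)) : X → Matrix ι ι ℝ := fun x =>
  coordMat e (adCLM ℝ (U.2.2 x)) + ∑ μ, (coordMat e (Phi2 η (adCLM ℝ (U.1 μ x))) + coordMat e (Phi2 (-η) (adCLM ℝ (U.2.1 μ x))))

omit [Fintype J] in
/-- Unfolding (forward). [folklore] -/
theorem v1coefAX_inl (η : ℝ) (U : (J → X → 𝔄) × (J → X → 𝔄) × (X → 𝔄)) (μ : J) (x : X) :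
    v1coefAX e η U (Sum.inl μ) x = coordMat e (adCLM ℝ (U.1 μ x)) + η • coordMat e (Phi2 η (adCLM ℝ (U.1 μ x))) := rfl

omit [Fintype J] in
/-- Unfolding (backward). [folklore] -/
theorem v1coefAX_inr (η : ℝ) (U : (J → X → 𝔄) × (J → X → 𝔄) × (X → 𝔄)) (μ : J) (x : X) :
    v1coefAX e η U (Sum.inr μ) x = coordMat e (adCLM ℝ (U.2.1 μ x)) - η • coordMat e (Phi2 (-η) (adCLM ℝ (U.2.1 μ x))) := rfl

omit [Fintype J] in
/-- The coefficients in TRANSPORT form: `a⁺_μ = coordMat(Φ₁(η, ad A⁺_μ))`. [folklore] -/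
theorem v1coefAX_inl_eq_Phi1 (η : ℝ) (U : (J → X → 𝔄) × (J → X → 𝔄) × (X → 𝔄)) (μ : J) (x : X) :
    v1coefAX e η U (Sum.inl μ) x = coordMat e (Phi1 η (adCLM ℝ (U.1 μ x))) := by
  rw [v1coefAX_inl, Phi1_eq_add_smul_Phi2, coordMat_add, coordMat_smul]

omit [Fintype J] in
/-- … and `a⁻_μ = coordMat(Φ₁(−η, ad A⁻_μ))` — the forward species AT NEGATIVE SPACING. [folklore] -/
theorem v1coefAX_inr_eq_Phi1 (η : ℝ) (U : (J → X → 𝔄) × (J → X → 𝔄) × (X → 𝔄)) (μ : J) (x : X) :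
    v1coefAX e η U (Sum.inr μ) x = coordMat e (Phi1 (-η) (adCLM ℝ (U.2.1 μ x))) := by
  rw [v1coefAX_inr, Phi1_eq_add_smul_Phi2, coordMat_add, coordMat_smul, neg_smul, sub_eq_add_neg]

/-- THE FORWARD TRANSPORT COEFFICIENT IS THE EXACT `a⁺`: `η⁻¹(coordMat(e^{ηZ}) − 1) = coordMat(Φ₁(η, Z))` (`η ≠ 0`). [cite: Balaban1985BackgroundPropagators, (3.51) p.400] -/
theorem tCoefA_gaugeTransport_inl {η : ℝ} (hη : η ≠ 0) (τ : J → X ≃ X) (A : J → X → 𝔄) (μ : J) (x : X) :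
    tCoefA η (gaugeTransport e τ η A) (Sum.inl μ) x = v1coefAX e η (v1fieldsOfGauge 𝔄 J τ η A) (Sum.inl μ) x := by
  rw [v1coefAX_inl_eq_Phi1, tCoefA_inl, Phi1_eq_smul hη, coordMat_smul, coordMat_sub, coordMat_one]
  rfl

/-- THE BACKWARD TRANSPORT COEFFICIENT IS THE EXACT `a⁻`: `η⁻¹(1 − coordMat(e^{−ηZ})) = coordMat(Φ₁(−η, Z))`. [cite: Balaban1985BackgroundPropagators, (3.51) p.400] -/
theorem tCoefA_gaugeTransport_inr {η : ℝ} (hη : η ≠ 0) (τ : J → X ≃ X) (A : J → X → 𝔄) (μ : J) (x : X) :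
    tCoefA η (gaugeTransport e τ η A) (Sum.inr μ) x = v1coefAX e η (v1fieldsOfGauge 𝔄 J τ η A) (Sum.inr μ) x := by
  rw [v1coefAX_inr_eq_Phi1, tCoefA_inr, Phi1_neg_eq_smul hη, coordMat_smul, coordMat_sub, coordMat_one]
  rfl

/-- `tCoefA (gaugeTransport) = v1coefAX` as coefficient families. [cite: Balaban1985BackgroundPropagators, (3.51)–(3.52) p.400] -/
theorem tCoefA_gaugeTransport {η : ℝ} (hη : η ≠ 0) (τ : J → X ≃ X) (A : J → X → 𝔄) :
    tCoefA η (gaugeTransport e τ η A) = v1coefAX e η (v1fieldsOfGauge 𝔄 J τ η A) := by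
  funext s x
  cases s with
  | inl μ => exact tCoefA_gaugeTransport_inl e hη τ A μ x
  | inr μ => exact tCoefA_gaugeTransport_inr e hη τ A μ x

/-- `tCoefC (gaugeTransport) = v1coefCX`: `η⁻¹Σ_μ(a⁺_μ − a⁻_μ) = coordMat(ad W) + Σ_μ[coordMat F′_η(ad A⁺_μ) + coordMat F′_{−η}(ad A⁻_μ)]`, `W = Σ_μ η⁻¹(A⁺_μ − A⁻_μ)` the `U ≡ 1`
covariant divergence (g2 V1b `v1fieldsOfGauge`). [cite: Balaban1985BackgroundPropagators, (3.51)–(3.52) p.400] -/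
theorem tCoefC_gaugeTransport {η : ℝ} (hη : η ≠ 0) (τ : J → X ≃ X) (A : J → X → 𝔄) :
    tCoefC η (gaugeTransport e τ η A) = v1coefCX e η (v1fieldsOfGauge 𝔄 J τ η A) := by
  funext x
  rw [tCoefC]
  simp only [tCoefA_gaugeTransport_inl e hη, tCoefA_gaugeTransport_inr e hη, v1coefAX_inl, v1coefAX_inr, v1coefCX]
  have hW : coordMat e (adCLM ℝ ((v1fieldsOfGauge 𝔄 J τ η A).2.2 x)) = ∑ μ, η⁻¹ • (coordMat e (adCLM ℝ (A μ x)) - coordMat e (adCLM ℝ (A μ ((τ μ).symm x)))) := by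
    simp only [v1fieldsOfGauge, smul_coordMat_ad_sub]
    rw [← coordMat_sum]
    congr 1
    simp only [adCLM_eq_adL]
    exact map_sum (adL ℝ : 𝔄 →L[ℝ] 𝔄 →L[ℝ] 𝔄) _ _
  rw [hW, ← Finset.sum_add_distrib, Finset.smul_sum]
  refine Finset.sum_congr rfl fun μ _ => ?_
  simp only [v1fieldsOfGauge]
  rw [show coordMat e (adCLM ℝ (A μ x)) + η • coordMat e (Phi2 η (adCLM ℝ (A μ x))) -
      (coordMat e (adCLM ℝ (A μ ((τ μ).symm x))) - η • coordMat e (Phi2 (-η) (adCLM ℝ (A μ ((τ μ).symm x))))) =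
      (coordMat e (adCLM ℝ (A μ x)) - coordMat e (adCLM ℝ (A μ ((τ μ).symm x)))) +
        η • (coordMat e (Phi2 η (adCLM ℝ (A μ x))) + coordMat e (Phi2 (-η) (adCLM ℝ (A μ ((τ μ).symm x))))) by
    rw [smul_add]; abel]
  rw [smul_add, smul_smul, inv_mul_cancel₀ hη, one_smul]

/-- ★★ **(3.53) AT `U ≡ 1` FOR A LIVE GAUGE FIELD, EXACT, IN THE KERNEL**: the covariant Laplacian of the transports `exp(±η ad A)` on the product carrier IS the flat Laplacian
MINUS the species operator of the exact coefficients `(v1coefCX, v1coefAX)` at `n = η⁻¹` — «Δ_{U′} = Δ − V′₁(A)», `U′ = e^{iηA}`, every order in `A` included.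
[cite: Balaban1985BackgroundPropagators, (3.50)–(3.53) p.400] -/
theorem covLapM_gaugeTransport_eq {η : ℝ} (hη : η ≠ 0) (τ : J → X ≃ X) (A : J → X → 𝔄) :
    covLapM τ η (gaugeTransport e τ η A) =
      covLapM τ η (fun _ _ => 1) - speciesOpM τ η⁻¹ (v1coefCX e η (v1fieldsOfGauge 𝔄 J τ η A)) (v1coefAX e η (v1fieldsOfGauge 𝔄 J τ η A)) := by
  rw [covLapM_eq_one_sub_speciesOpM τ η, tCoefC_gaugeTransport e hη, tCoefA_gaugeTransport e hη]

/-! ## §3 The located sign: g2's `v1coefA` ∕ `v1coefC` against the exact coefficients -/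

omit [Fintype J] in
/-- FORWARD COMPONENTS AGREE with g2 V1a's `v1coefA`. [folklore] -/
theorem v1coefAX_inl_eq_v1coefA (η : ℝ) (U : (J → X → 𝔄) × (J → X → 𝔄) × (X → 𝔄)) (μ : J) (x : X) :
    v1coefAX e η U (Sum.inl μ) x = v1coefA e η U (Sum.inl μ) x := by
  rw [v1coefAX_inl, v1coefA_inl]

omit [Fintype J] in
/-- THE LOCATED DISCREPANCY, backward first-order coefficients: `a⁻(g2) − a⁻(exact) = η·[coordMat F′_η(−Z) − coordMat F′_η(Z)]`, `Z = ad A⁻_μ(x)` — g2's `v1coefA` reads `F′_η(+ad A⁻)`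
where (3.50) gives `F′_η(−ad A⁻)`; the bracket is odd in `Z`, of third order (`F′_η(Z) − F′_η(−Z) = η⁻²(e^{ηZ} − e^{−ηZ} − 2ηZ)`). [cite: Balaban1985BackgroundPropagators, (3.50)–(3.52) p.400] -/
theorem v1coefA_inr_sub_v1coefAX_inr (η : ℝ) (U : (J → X → 𝔄) × (J → X → 𝔄) × (X → 𝔄)) (μ : J) (x : X) :
    v1coefA e η U (Sum.inr μ) x - v1coefAX e η U (Sum.inr μ) x =
      η • (coordMat e (Phi2 η (-adCLM ℝ (U.2.1 μ x))) - coordMat e (Phi2 η (adCLM ℝ (U.2.1 μ x)))) := by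
  rw [v1coefA_inr, v1coefAX_inr, Phi2_neg, smul_sub]
  abel

/-- THE LOCATED DISCREPANCY, zeroth-order coefficient: `c(g2) − c(exact) = Σ_μ [coordMat F′_η(Z_μ) − coordMat F′_η(−Z_μ)]`, `Z_μ = ad A⁻_μ(x)`.
[cite: Balaban1985BackgroundPropagators, (3.50)–(3.52) p.400] -/
theorem v1coefC_sub_v1coefCX (η : ℝ) (U : (J → X → 𝔄) × (J → X → 𝔄) × (X → 𝔄)) (x : X) :
    v1coefC e η U x - v1coefCX e η U x = ∑ μ, (coordMat e (Phi2 η (adCLM ℝ (U.2.1 μ x))) - coordMat e (Phi2 η (-adCLM ℝ (U.2.1 μ x)))) := by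
  simp only [v1coefC, v1coefCX, Phi2_neg]
  rw [add_sub_add_left_eq_sub, ← Finset.sum_sub_distrib]
  exact Finset.sum_congr rfl fun μ _ => by abel

end Gauge

end Summit.QuantumFields.YangMills.BalabanUVNodes.N15.BackgroundLayer
end
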